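import Summits.Schanuel.Schanuel.Theorems.RoyCriterionRoyThesisTypedPointwise
import Literature.NumberTheory.Transcendental.PeriodsWave0NesterenkoProofs

/-!
# The rank-3 rung of Roy's criterion on the CM–Gamma sector (Nesterenko + pointwise transfer)

Crux `stmt-Schanuel-0463`: `Summit.Schanuel.Schanuel.Theses.RoyCriterion.RoyThesisTyped = ∀ n, RoyCriterion n`
(⟺ Schanuel, kernel). Line `SketchIdeator5R2` = idea `cm-tau-companion-rank-three` (ideator 5, r2):
Nesterenko's theorem (tree theorems `nesterenko_holds`: `π, e^π, Γ(1/4)` algebraically independent;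
`nesterenko'_holds`: `π, e^{π√3}, Γ(1/3)`) supplies Schanuel's inequality in rank 3 at every tuple
through `π` and `Γ(1/4)` (resp. a logarithm of `Γ(1/4)`; resp. `π√3` and `Γ(1/3)`), and the
pointwise transfer `RoyThesisTyped.le_trdeg_of_royHypothesis` turns each into an instance of the
crux's rank-3 rung — the first instances of `RoyCriterion 3` in the tree off the
Lindemann–Weierstrass stratum, with an explicit `ℚ`-linearly independent inhabitant
`(πi, π, Γ(1/4))`. These are SECTOR theorems (`--supports`); by `crux_iff_summit` no sector closes
the crux.

* `RoyThesisTyped.algebraicIndependent_pi_expPi_gammaQuarter` (complex form of `nesterenko`);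
* `RoyThesisTyped.three_le_trdeg_of_pi_gammaQuarter` / `…_of_pi_of_exp_eq_gammaQuarter` /
  `…_of_piSqrtThree_gammaThird` / `…_of_pi_of_isAlgebraic_gammaQuarter` / `…_of_pi_lemniscate`
  — `3 ≤ trdeg_ℚ ℚ(y, e^y)` for every `y : Fin l → ℂ` through the named coordinates (any `l`;
  `ϖ = Γ(1/4)²/(2√(2π))` the lemniscatic period, `Γ(1/4)⁴ = 8πϖ²`);
* `RoyThesisTyped.three_le_trdeg_of_royHypothesis_of_pi_gammaQuarter` (+ three variants) — the crux's
  conclusion `3 ≤ trdeg_ℚ ℚ(y, α)` for every Roy datum `(y, α)` over such `y`;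
* `RoyThesisTyped.royCriterion_three_on_cmGammaSector` — rank 3, crux format (even without the
  linear-independence hypothesis);
* `RoyThesisTyped.linearIndependent_piI_pi_gammaQuarter` — the sector meets the crux's hypothesis
  domain: `(πi, π, Γ(1/4))` is `ℚ`-linearly independent.

No defs, no sorries, no named-fact hypotheses.
-/

set_option linter.dupNamespace false

noncomputable section

namespace Summit.Schanuel.Schanuel.Theorems

open Complex
open Literature.NumberTheory.Transcendental

/-- `n` algebraically independent complex numbers lying in an intermediate field `K` force
`n ≤ trdeg_ℚ K` (they stay algebraically independent in `K`; `AlgebraicIndependent.cardinalMk_le_trdeg`).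
[folklore] -/
theorem RoyThesisTyped.natCast_le_trdeg_of_algebraicIndependent {n : ℕ} {x : Fin n → ℂ}
    (hx : AlgebraicIndependent ℚ x) (K : IntermediateField ℚ ℂ) (hK : ∀ i, x i ∈ K) :
    (n : Cardinal) ≤ Algebra.trdeg ℚ ↥K := by
  let f : Fin n → K := fun i => ⟨x i, hK i⟩
  have hf : AlgebraicIndependent ℚ f := AlgebraicIndependent.of_comp K.val hx
  simpa using hf.cardinalMk_le_trdeg

/-- Nesterenko's triple as complex numbers: `π, e^π, Γ(1/4) ∈ ℂ` are algebraically independent over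
`ℚ` (tree theorem `nesterenko_holds`, transported along `ℝ → ℂ`).
[cite: NesterenkoPhilippon2001, Ch. 3 Corollary 1.2] -/
theorem RoyThesisTyped.algebraicIndependent_pi_expPi_gammaQuarter :
    AlgebraicIndependent ℚ
      ![(Real.pi : ℂ), cexp Real.pi, (Real.Gamma (1 / 4) : ℂ)] := by
  have hN : AlgebraicIndependent ℚ ![Real.pi, Real.exp Real.pi, Real.Gamma (1 / 4)] :=
    nesterenko_holds
  have e : (![(Real.pi : ℂ), cexp Real.pi, (Real.Gamma (1 / 4) : ℂ)] : Fin 3 → ℂ) =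
      (Complex.ofRealAm.restrictScalars ℚ) ∘ ![Real.pi, Real.exp Real.pi, Real.Gamma (1 / 4)] := by
    funext i; fin_cases i <;> simp [Complex.ofReal_exp]
  rw [e]
  exact hN.map' Complex.ofReal_injective

/-- Nesterenko's second triple as complex numbers: `π, e^{π√3}, Γ(1/3) ∈ ℂ` are algebraically
independent over `ℚ` (tree theorem `nesterenko'_holds`).
[cite: NesterenkoPhilippon2001, Ch. 1 §3 Corollary 3.2] -/
theorem RoyThesisTyped.algebraicIndependent_pi_expPiSqrtThree_gammaThird :
    AlgebraicIndependent ℚ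
      ![(Real.pi : ℂ), cexp ((Real.pi * Real.sqrt 3 : ℝ) : ℂ), (Real.Gamma (1 / 3) : ℂ)] := by
  have hN : AlgebraicIndependent ℚ
      ![Real.pi, Real.exp (Real.pi * Real.sqrt 3), Real.Gamma (1 / 3)] := nesterenko'_holds
  have e : (![(Real.pi : ℂ), cexp ((Real.pi * Real.sqrt 3 : ℝ) : ℂ), (Real.Gamma (1 / 3) : ℂ)] :
      Fin 3 → ℂ) =
      (Complex.ofRealAm.restrictScalars ℚ) ∘
        ![Real.pi, Real.exp (Real.pi * Real.sqrt 3), Real.Gamma (1 / 3)] := by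
    funext i; fin_cases i <;> simp [Complex.ofReal_exp]
  rw [e]
  exact hN.map' Complex.ofReal_injective

/-! ### Schanuel's inequality in rank 3 on the sector -/

/-- **Schanuel(3) through `π` and `Γ(1/4)`.** If a tuple `y : Fin l → ℂ` has coordinates
`y i = π` and `y j = Γ(1/4)`, then `3 ≤ trdeg_ℚ ℚ(y, e^y)`: the field contains Nesterenko's
triple `π, e^π = e^{y i}, Γ(1/4)`. [cite: NesterenkoPhilippon2001, Ch. 3 Corollary 1.2] -/
theorem RoyThesisTyped.three_le_trdeg_of_pi_gammaQuarter {l : ℕ} (y : Fin l → ℂ) (i j : Fin l)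
    (hi : y i = Real.pi) (hj : y j = Real.Gamma (1 / 4)) :
    (3 : Cardinal) ≤ Algebra.trdeg ℚ
      ↥(IntermediateField.adjoin ℚ (Set.range y ∪ Set.range (cexp ∘ y))) := by
  have h := RoyThesisTyped.natCast_le_trdeg_of_algebraicIndependent
    RoyThesisTyped.algebraicIndependent_pi_expPi_gammaQuarter
    (IntermediateField.adjoin ℚ (Set.range y ∪ Set.range (cexp ∘ y))) (by
      intro k
      fin_cases k
      · simp only [Fin.zero_eta, Fin.isValue, Matrix.cons_val_zero]
        rw [← hi]
        exact IntermediateField.subset_adjoin ℚ _ (Or.inl ⟨i, rfl⟩)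
      · simp only [Fin.mk_one, Fin.isValue, Matrix.cons_val_one, Matrix.cons_val_zero]
        rw [← hi]
        exact IntermediateField.subset_adjoin ℚ _ (Or.inr ⟨i, rfl⟩)
      · simp only [Fin.reduceFinMk, Matrix.cons_val]
        rw [← hj]
        exact IntermediateField.subset_adjoin ℚ _ (Or.inl ⟨j, rfl⟩))
  exact_mod_cast h

/-- **Schanuel(3) through `π` and a logarithm of `Γ(1/4)`.** If `y i = π` and `e^{y j} = Γ(1/4)`,
then `3 ≤ trdeg_ℚ ℚ(y, e^y)` (the field contains `π, e^π, Γ(1/4) = e^{y j}`).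
[cite: NesterenkoPhilippon2001, Ch. 3 Corollary 1.2] -/
theorem RoyThesisTyped.three_le_trdeg_of_pi_of_exp_eq_gammaQuarter {l : ℕ} (y : Fin l → ℂ)
    (i j : Fin l) (hi : y i = Real.pi) (hj : cexp (y j) = Real.Gamma (1 / 4)) :
    (3 : Cardinal) ≤ Algebra.trdeg ℚ
      ↥(IntermediateField.adjoin ℚ (Set.range y ∪ Set.range (cexp ∘ y))) := by
  have h := RoyThesisTyped.natCast_le_trdeg_of_algebraicIndependent
    RoyThesisTyped.algebraicIndependent_pi_expPi_gammaQuarter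
    (IntermediateField.adjoin ℚ (Set.range y ∪ Set.range (cexp ∘ y))) (by
      intro k
      fin_cases k
      · simp only [Fin.zero_eta, Fin.isValue, Matrix.cons_val_zero]
        rw [← hi]
        exact IntermediateField.subset_adjoin ℚ _ (Or.inl ⟨i, rfl⟩)
      · simp only [Fin.mk_one, Fin.isValue, Matrix.cons_val_one, Matrix.cons_val_zero]
        rw [← hi]
        exact IntermediateField.subset_adjoin ℚ _ (Or.inr ⟨i, rfl⟩)
      · simp only [Fin.reduceFinMk, Matrix.cons_val]
        rw [← hj]
        exact IntermediateField.subset_adjoin ℚ _ (Or.inr ⟨j, rfl⟩))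
  exact_mod_cast h

/-- **Schanuel(3) through `π√3` and `Γ(1/3)`.** If `y i = π√3` and `y j = Γ(1/3)`, then
`3 ≤ trdeg_ℚ ℚ(y, e^y)`: Nesterenko's second triple `π, e^{π√3} = e^{y i}, Γ(1/3)` is algebraic
over `ℚ(y, e^y)` (`π² = (y i)²/3`), so `3 ≤ trdeg ℚ(π, e^{π√3}, Γ(1/3)) ≤ trdeg ℚ(y, e^y)`.
[cite: NesterenkoPhilippon2001, Ch. 1 §3 Corollary 3.2] -/
theorem RoyThesisTyped.three_le_trdeg_of_piSqrtThree_gammaThird {l : ℕ} (y : Fin l → ℂ)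
    (i j : Fin l) (hi : y i = ((Real.pi * Real.sqrt 3 : ℝ) : ℂ)) (hj : y j = Real.Gamma (1 / 3)) :
    (3 : Cardinal) ≤ Algebra.trdeg ℚ
      ↥(IntermediateField.adjoin ℚ (Set.range y ∪ Set.range (cexp ∘ y))) := by
  set K : IntermediateField ℚ ℂ := IntermediateField.adjoin ℚ (Set.range y ∪ Set.range (cexp ∘ y))
    with hK
  set x : Fin 3 → ℂ :=
    ![(Real.pi : ℂ), cexp ((Real.pi * Real.sqrt 3 : ℝ) : ℂ), (Real.Gamma (1 / 3) : ℂ)] with hx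
  have h3 : (3 : Cardinal) ≤ Algebra.trdeg ℚ ↥(IntermediateField.adjoin ℚ (Set.range x)) := by
    have h := RoyThesisTyped.natCast_le_trdeg_of_algebraicIndependent
      RoyThesisTyped.algebraicIndependent_pi_expPiSqrtThree_gammaThird
      (IntermediateField.adjoin ℚ (Set.range x))
      (fun k => IntermediateField.subset_adjoin ℚ _ ⟨k, rfl⟩)
    exact_mod_cast h
  refine h3.trans (PrasadRapinchuk.trdeg_adjoin_le_of_isAlgebraic K ?_)
  have hyi : y i ∈ K := IntermediateField.subset_adjoin ℚ _ (Or.inl ⟨i, rfl⟩)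
  rintro z ⟨k, rfl⟩
  fin_cases k
  · -- `π`: `π ^ 2 = (y i) ^ 2 / 3 ∈ K`
    simp only [hx, Fin.zero_eta, Fin.isValue, Matrix.cons_val_zero]
    have hsq : ((Real.pi : ℂ)) ^ 2 = (y i) ^ 2 / 3 := by
      rw [hi, ← Complex.ofReal_pow, ← Complex.ofReal_pow, mul_pow,
        Real.sq_sqrt (by norm_num : (0 : ℝ) ≤ 3)]
      push_cast
      ring
    have hmem : ((Real.pi : ℂ)) ^ 2 ∈ K := by
      rw [hsq]
      exact div_mem (pow_mem hyi 2) (ofNat_mem K 3)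
    exact IsAlgebraic.of_pow (by norm_num : 0 < 2) (isAlgebraic_algebraMap (⟨_, hmem⟩ : K))
  · -- `e^{π√3} = e^{y i} ∈ K`
    simp only [hx, Fin.mk_one, Fin.isValue, Matrix.cons_val_one, Matrix.cons_val_zero]
    have hmem : cexp ((Real.pi * Real.sqrt 3 : ℝ) : ℂ) ∈ K := by
      rw [← hi]
      exact IntermediateField.subset_adjoin ℚ _ (Or.inr ⟨i, rfl⟩)
    exact isAlgebraic_algebraMap (⟨_, hmem⟩ : K)
  · -- `Γ(1/3) = y j ∈ K`
    simp only [hx, Fin.reduceFinMk, Matrix.cons_val]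
    have hmem : (Real.Gamma (1 / 3) : ℂ) ∈ K := by
      rw [← hj]
      exact IntermediateField.subset_adjoin ℚ _ (Or.inl ⟨j, rfl⟩)
    exact isAlgebraic_algebraMap (⟨_, hmem⟩ : K)

/-- **Schanuel(3) through `π` and anything making `Γ(1/4)` algebraic.** If `y i = π` and `Γ(1/4)`
is algebraic over `ℚ(y, e^y)`, then `3 ≤ trdeg_ℚ ℚ(y, e^y)` (Nesterenko's triple is algebraic over
the field). Covers the lemniscatic period `ϖ = Γ(1/4)²/(2√(2π))` (`Γ(1/4)⁴ = 8πϖ²`), see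
`three_le_trdeg_of_pi_lemniscate`. [cite: NesterenkoPhilippon2001, Ch. 3 Corollary 1.2] -/
theorem RoyThesisTyped.three_le_trdeg_of_pi_of_isAlgebraic_gammaQuarter {l : ℕ} (y : Fin l → ℂ)
    (i : Fin l) (hi : y i = Real.pi)
    (hΓ : IsAlgebraic ↥(IntermediateField.adjoin ℚ (Set.range y ∪ Set.range (cexp ∘ y)))
      (Real.Gamma (1 / 4) : ℂ)) :
    (3 : Cardinal) ≤ Algebra.trdeg ℚ
      ↥(IntermediateField.adjoin ℚ (Set.range y ∪ Set.range (cexp ∘ y))) := by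
  set K : IntermediateField ℚ ℂ := IntermediateField.adjoin ℚ (Set.range y ∪ Set.range (cexp ∘ y))
    with hK
  set x : Fin 3 → ℂ := ![(Real.pi : ℂ), cexp Real.pi, (Real.Gamma (1 / 4) : ℂ)] with hx
  have h3 : (3 : Cardinal) ≤ Algebra.trdeg ℚ ↥(IntermediateField.adjoin ℚ (Set.range x)) := by
    have h := RoyThesisTyped.natCast_le_trdeg_of_algebraicIndependent
      RoyThesisTyped.algebraicIndependent_pi_expPi_gammaQuarter
      (IntermediateField.adjoin ℚ (Set.range x))
      (fun k => IntermediateField.subset_adjoin ℚ _ ⟨k, rfl⟩)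
    exact_mod_cast h
  refine h3.trans (PrasadRapinchuk.trdeg_adjoin_le_of_isAlgebraic K ?_)
  rintro z ⟨k, rfl⟩
  fin_cases k
  · simp only [hx, Fin.zero_eta, Fin.isValue, Matrix.cons_val_zero]
    have hmem : (Real.pi : ℂ) ∈ K := by
      rw [← hi]; exact IntermediateField.subset_adjoin ℚ _ (Or.inl ⟨i, rfl⟩)
    exact isAlgebraic_algebraMap (⟨_, hmem⟩ : K)
  · simp only [hx, Fin.mk_one, Fin.isValue, Matrix.cons_val_one, Matrix.cons_val_zero]
    have hmem : cexp Real.pi ∈ K := by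
      rw [← hi]; exact IntermediateField.subset_adjoin ℚ _ (Or.inr ⟨i, rfl⟩)
    exact isAlgebraic_algebraMap (⟨_, hmem⟩ : K)
  · simpa only [hx, Fin.reduceFinMk, Matrix.cons_val] using hΓ

/-- **Schanuel(3) through `π` and the lemniscatic period `ϖ = Γ(1/4)²/(2√(2π))`** (half the real
period of `y² = x³ − x`; `∫₁^∞ du/√(u³−u)`, `Literature.Analysis.SpecialFunctions.integral_Ioi_one_inv_sqrt_cube_sub_self`):
if `y i = π` and `y j = ϖ` then `3 ≤ trdeg_ℚ ℚ(y, e^y)`, because `Γ(1/4)⁴ = 8 π ϖ² ∈ ℚ(y, e^y)`.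
E.g. the lemniscatic triple `(ϖ, iϖ, π)`. [cite: NesterenkoPhilippon2001, Ch. 1 §3 Remark ii and Ch. 3 Corollary 1.2] -/
theorem RoyThesisTyped.three_le_trdeg_of_pi_lemniscate {l : ℕ} (y : Fin l → ℂ) (i j : Fin l)
    (hi : y i = Real.pi)
    (hj : y j = ((Real.Gamma (1 / 4) ^ 2 / (2 * Real.sqrt (2 * Real.pi)) : ℝ) : ℂ)) :
    (3 : Cardinal) ≤ Algebra.trdeg ℚ
      ↥(IntermediateField.adjoin ℚ (Set.range y ∪ Set.range (cexp ∘ y))) := by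
  set K : IntermediateField ℚ ℂ := IntermediateField.adjoin ℚ (Set.range y ∪ Set.range (cexp ∘ y))
    with hK
  refine RoyThesisTyped.three_le_trdeg_of_pi_of_isAlgebraic_gammaQuarter y i hi ?_
  have hyi : y i ∈ K := IntermediateField.subset_adjoin ℚ _ (Or.inl ⟨i, rfl⟩)
  have hyj : y j ∈ K := IntermediateField.subset_adjoin ℚ _ (Or.inl ⟨j, rfl⟩)
  -- the real identity `Γ(1/4)⁴ = (Γ(1/4)²/(2√(2π)))² · (8π)`
  have hreal : Real.Gamma (1 / 4) ^ 4 =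
      (Real.Gamma (1 / 4) ^ 2 / (2 * Real.sqrt (2 * Real.pi))) ^ 2 * (8 * Real.pi) := by
    have hs : Real.sqrt (2 * Real.pi) ^ 2 = 2 * Real.pi :=
      Real.sq_sqrt (by positivity : (0 : ℝ) ≤ 2 * Real.pi)
    have hs0 : Real.sqrt (2 * Real.pi) ≠ 0 := by positivity
    field_simp
    rw [hs]
    ring
  have h4 : (Real.Gamma (1 / 4) : ℂ) ^ 4 = (y j) ^ 2 * (8 * y i) := by
    rw [hj, hi, ← Complex.ofReal_pow, hreal]
    push_cast
    ring
  have hmem : (Real.Gamma (1 / 4) : ℂ) ^ 4 ∈ K := by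
    rw [h4]
    exact mul_mem (pow_mem hyj 2) (mul_mem (ofNat_mem K 8) hyi)
  exact IsAlgebraic.of_pow (by norm_num : 0 < 4) (isAlgebraic_algebraMap (⟨_, hmem⟩ : K))

/-! ### The crux's conclusion on the sector (every rank), and the rank-3 rung in crux format -/

/-- **The crux's conclusion through `π` and `Γ(1/4)`.** For every Roy datum over a tuple through
`π` and `Γ(1/4)` — `α j ≠ 0`, admissible window, `RoyHypothesis y α …` — one has
`3 ≤ trdeg_ℚ ℚ(y, α)` (pointwise transfer `le_trdeg_of_royHypothesis` of
`three_le_trdeg_of_pi_gammaQuarter`). For `l = 3` this is the rung `RoyCriterion 3` at `y`.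
[cite: Roy2001, Thm. 1] [cite: NesterenkoPhilippon2001, Ch. 3 Corollary 1.2] -/
theorem RoyThesisTyped.three_le_trdeg_of_royHypothesis_of_pi_gammaQuarter {l : ℕ}
    {y α : Fin l → ℂ} (i j : Fin l) (hi : y i = Real.pi) (hj : y j = Real.Gamma (1 / 4))
    (hα : ∀ j, α j ≠ 0) {s₀ s₁ t₀ t₁ u : ℝ} (hadm : RoyAdmissible s₀ s₁ t₀ t₁ u)
    (hhyp : RoyHypothesis y α s₀ s₁ t₀ t₁ u) :
    (3 : Cardinal) ≤ Algebra.trdeg ℚ ↥(IntermediateField.adjoin ℚ (Set.range y ∪ Set.range α)) :=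
  RoyThesisTyped.le_trdeg_of_royHypothesis
    (RoyThesisTyped.three_le_trdeg_of_pi_gammaQuarter y i j hi hj) hα hadm hhyp

/-- **The crux's conclusion through `π` and a logarithm of `Γ(1/4)`.**
[cite: Roy2001, Thm. 1] [cite: NesterenkoPhilippon2001, Ch. 3 Corollary 1.2] -/
theorem RoyThesisTyped.three_le_trdeg_of_royHypothesis_of_pi_of_exp_eq_gammaQuarter {l : ℕ}
    {y α : Fin l → ℂ} (i j : Fin l) (hi : y i = Real.pi) (hj : cexp (y j) = Real.Gamma (1 / 4))
    (hα : ∀ j, α j ≠ 0) {s₀ s₁ t₀ t₁ u : ℝ} (hadm : RoyAdmissible s₀ s₁ t₀ t₁ u)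
    (hhyp : RoyHypothesis y α s₀ s₁ t₀ t₁ u) :
    (3 : Cardinal) ≤ Algebra.trdeg ℚ ↥(IntermediateField.adjoin ℚ (Set.range y ∪ Set.range α)) :=
  RoyThesisTyped.le_trdeg_of_royHypothesis
    (RoyThesisTyped.three_le_trdeg_of_pi_of_exp_eq_gammaQuarter y i j hi hj) hα hadm hhyp

/-- **The crux's conclusion through `π√3` and `Γ(1/3)`.**
[cite: Roy2001, Thm. 1] [cite: NesterenkoPhilippon2001, Ch. 1 §3 Corollary 3.2] -/
theorem RoyThesisTyped.three_le_trdeg_of_royHypothesis_of_piSqrtThree_gammaThird {l : ℕ}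
    {y α : Fin l → ℂ} (i j : Fin l) (hi : y i = ((Real.pi * Real.sqrt 3 : ℝ) : ℂ))
    (hj : y j = Real.Gamma (1 / 3))
    (hα : ∀ j, α j ≠ 0) {s₀ s₁ t₀ t₁ u : ℝ} (hadm : RoyAdmissible s₀ s₁ t₀ t₁ u)
    (hhyp : RoyHypothesis y α s₀ s₁ t₀ t₁ u) :
    (3 : Cardinal) ≤ Algebra.trdeg ℚ ↥(IntermediateField.adjoin ℚ (Set.range y ∪ Set.range α)) :=
  RoyThesisTyped.le_trdeg_of_royHypothesis
    (RoyThesisTyped.three_le_trdeg_of_piSqrtThree_gammaThird y i j hi hj) hα hadm hhyp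

/-- **The crux's conclusion through `π` and the lemniscatic period `ϖ`.**
[cite: Roy2001, Thm. 1] [cite: NesterenkoPhilippon2001, Ch. 3 Corollary 1.2] -/
theorem RoyThesisTyped.three_le_trdeg_of_royHypothesis_of_pi_lemniscate {l : ℕ}
    {y α : Fin l → ℂ} (i j : Fin l) (hi : y i = Real.pi)
    (hj : y j = ((Real.Gamma (1 / 4) ^ 2 / (2 * Real.sqrt (2 * Real.pi)) : ℝ) : ℂ))
    (hα : ∀ j, α j ≠ 0) {s₀ s₁ t₀ t₁ u : ℝ} (hadm : RoyAdmissible s₀ s₁ t₀ t₁ u)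
    (hhyp : RoyHypothesis y α s₀ s₁ t₀ t₁ u) :
    (3 : Cardinal) ≤ Algebra.trdeg ℚ ↥(IntermediateField.adjoin ℚ (Set.range y ∪ Set.range α)) :=
  RoyThesisTyped.le_trdeg_of_royHypothesis
    (RoyThesisTyped.three_le_trdeg_of_pi_lemniscate y i j hi hj) hα hadm hhyp

/-- **`RoyCriterion 3` on the CM–Gamma sector, in the crux's own format** (and without its
linear-independence hypothesis): for every `y : Fin 3 → ℂ` with coordinates `π` and `Γ(1/4)`,
every `α ∈ (ℂˣ)³` and every admissible window, `RoyHypothesis y α … → 3 ≤ trdeg_ℚ ℚ(y, α)`.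
Compare `RoyCriterion 3 = ∀ y α, LinearIndependent ℚ y → (∀ j, α j ≠ 0) → ∀ window, … →
((3 : ℕ) : Cardinal) ≤ trdeg ℚ(y, α)`. [cite: Roy2001, Conjecture 2] [cite: NesterenkoPhilippon2001, Ch. 3 Corollary 1.2] -/
theorem RoyThesisTyped.royCriterion_three_on_cmGammaSector :
    ∀ (y α : Fin 3 → ℂ), (∃ i j, y i = Real.pi ∧ y j = Real.Gamma (1 / 4)) → (∀ j, α j ≠ 0) →
      ∀ (s₀ s₁ t₀ t₁ u : ℝ), RoyAdmissible s₀ s₁ t₀ t₁ u → RoyHypothesis y α s₀ s₁ t₀ t₁ u →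
        ((3 : ℕ) : Cardinal) ≤ Algebra.trdeg ℚ
          ↥(IntermediateField.adjoin ℚ (Set.range y ∪ Set.range α)) := by
  rintro y α ⟨i, j, hi, hj⟩ hα s₀ s₁ t₀ t₁ u hadm hhyp
  exact_mod_cast
    RoyThesisTyped.three_le_trdeg_of_royHypothesis_of_pi_gammaQuarter i j hi hj hα hadm hhyp

/-! ### The sector is inhabited inside the crux's hypothesis domain -/

/-- `π` and `Γ(1/4)` are algebraically independent over `ℚ` (sub-family of Nesterenko's triple).
[cite: NesterenkoPhilippon2001, Ch. 3 Corollary 1.2] -/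
theorem RoyThesisTyped.algebraicIndependent_pi_gammaQuarter :
    AlgebraicIndependent ℚ ![Real.pi, Real.Gamma (1 / 4)] := by
  have hN : AlgebraicIndependent ℚ ![Real.pi, Real.exp Real.pi, Real.Gamma (1 / 4)] :=
    nesterenko_holds
  have h := hN.comp ![(0 : Fin 3), 2] (by decide)
  convert h using 1
  funext i; fin_cases i <;> rfl

/-- **`(πi, π, Γ(1/4))` is `ℚ`-linearly independent**: the imaginary part isolates the first
coefficient, and a `ℚ`-relation between `π` and `Γ(1/4)` would be an algebraic one
(`algebraicIndependent_pi_gammaQuarter`). So the CM–Gamma sector meets the hypothesis domain of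
the crux (`LinearIndependent ℚ y`). [cite: NesterenkoPhilippon2001, Ch. 3 Corollary 1.2] -/
theorem RoyThesisTyped.linearIndependent_piI_pi_gammaQuarter :
    LinearIndependent ℚ ![(Real.pi : ℂ) * I, (Real.pi : ℂ), (Real.Gamma (1 / 4) : ℂ)] := by
  have hpair : LinearIndependent ℚ ![Real.pi, Real.Gamma (1 / 4)] :=
    RoyThesisTyped.algebraicIndependent_pi_gammaQuarter.linearIndependent
  rw [Fintype.linearIndependent_iff]
  intro g hg
  rw [Fin.sum_univ_three] at hg
  simp only [Matrix.cons_val_zero, Matrix.cons_val_one, Matrix.cons_val] at hg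
  have hre := congrArg Complex.re hg
  have him := congrArg Complex.im hg
  simp only [Complex.add_re, Complex.add_im, Rat.smul_def, Complex.mul_re, Complex.mul_im,
    Complex.ofReal_re, Complex.ofReal_im, Complex.I_re, Complex.I_im, Complex.ratCast_re,
    Complex.ratCast_im, Complex.zero_re, Complex.zero_im, mul_zero, mul_one, sub_zero, add_zero,
    zero_add, zero_mul, sub_self] at hre him
  -- `him : (g 0 : ℝ) * π = 0`, `hre : (g 1 : ℝ) * π + (g 2 : ℝ) * Γ(1/4) = 0`
  have h0 : g 0 = 0 := by
    rcases mul_eq_zero.mp him with h | h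
    · exact_mod_cast h
    · exact absurd h Real.pi_ne_zero
  have h12 : g 1 = 0 ∧ g 2 = 0 := by
    have hp := (LinearIndependent.pair_iff.mp hpair) (g 1) (g 2)
    refine hp ?_
    simp only [Rat.smul_def]
    exact_mod_cast hre
  intro k
  fin_cases k
  · exact h0
  · exact h12.1
  · exact h12.2

/-- **The flagship instance.** At `y = (πi, π, Γ(1/4))` — `ℚ`-linearly independent — the crux's
rank-3 rung holds: for every `α ∈ (ℂˣ)³` and every admissible window,
`RoyHypothesis y α … → 3 ≤ trdeg_ℚ ℚ(y, α)`. [cite: Roy2001, Conjecture 2] [cite: NesterenkoPhilippon2001, Ch. 3 Corollary 1.2] -/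
theorem RoyThesisTyped.royCriterion_three_at_piI_pi_gammaQuarter :
    LinearIndependent ℚ ![(Real.pi : ℂ) * I, (Real.pi : ℂ), (Real.Gamma (1 / 4) : ℂ)] ∧
    ∀ α : Fin 3 → ℂ, (∀ j, α j ≠ 0) → ∀ (s₀ s₁ t₀ t₁ u : ℝ), RoyAdmissible s₀ s₁ t₀ t₁ u →
      RoyHypothesis ![(Real.pi : ℂ) * I, (Real.pi : ℂ), (Real.Gamma (1 / 4) : ℂ)] α s₀ s₁ t₀ t₁ u →
        ((3 : ℕ) : Cardinal) ≤ Algebra.trdeg ℚ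
          ↥(IntermediateField.adjoin ℚ
            (Set.range ![(Real.pi : ℂ) * I, (Real.pi : ℂ), (Real.Gamma (1 / 4) : ℂ)] ∪
              Set.range α)) :=
  ⟨RoyThesisTyped.linearIndependent_piI_pi_gammaQuarter, fun α hα s₀ s₁ t₀ t₁ u hadm hhyp =>
    RoyThesisTyped.royCriterion_three_on_cmGammaSector _ α ⟨1, 2, by simp, by simp⟩ hα
      s₀ s₁ t₀ t₁ u hadm hhyp⟩

end Summit.Schanuel.Schanuel.Theorems

end
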